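import Literature.AlgebraicGeometry.HodgeTheory.CMTimesNonCMEllipticProductsHodgeClasses
import Literature.AlgebraicGeometry.ComplexMultiplication.CMTypeHodgeProjectorsPolynomial
import HarnessLib

/-!
# Hodge classes on (products of powers of non-CM elliptic curves) × (ANY abelian variety of CM type): Lombardo Lemma 3.4 / Moonen–Zarhin (3.2)(2), proved Hodge-group-free

Research context: cell `pub-hodge-ring2` (a route conditional on HC_CM; research route, not a
corollary of HC_CM; nothing here is a step of that route beyond the products named, and the
conditional statements below carry HC_CM as an explicit hypothesis, never as a fact). This file is
brick E13c — the assembly — of the Literature lane's formalisation of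

  Lombardo, Ann. Inst. Fourier 66 (2016), Lemma 3.4 (p. 1229; = Lemma 35 of arXiv:1402.1478):
  "Suppose `B` is of CM type and `A_K̄` has no simple factor of type IV. Then we have
  `H(A × B) ≅ H(A) × H(B)`."
  Moonen–Zarhin, Math. Ann. 315 (1999), Thm. (3.2)(2) (quoting Hazama): "Suppose `X₁` has no
  factors of Type 4 and `X₂` is of CM-type. Then `X₁ × X₂` again satisfies (D) and
  `Hg(X₁ × X₂) = Hg(X₁) × Hg(X₂)`",

read on Hodge classes (Moonen–Zarhin §3, first paragraph: when the Hodge group of the product is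
the product of the Hodge groups, the Hodge ring of `X₁ × X₂` is generated by the classes coming
from `X₁` and from `X₂`), for

  `X₁ = B` an abelian variety with a MULTI-CURVE SLOT STRUCTURE (`MultiEllSlots`) over elliptic
  curves WITHOUT complex multiplication (`EllipticCurve.HodgeEndTrivial`), pairwise NOT
  Hodge-isogenous — e.g. `E₀^{N₀+1} × ⋯ × E_r^{N_r+1}` (`multiPowSucc`) —, and
  `X₂ = A` ANY complex abelian variety OF CM TYPE in the étale sense `Milne1999.IsOfCMType A`
  (`End⁰(A)` contains a commutative reduced `ℚ`-subalgebra of degree `2 dim A`; Milne 1999 §2 p. 54,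
  Deligne LNM 900 §5) — the EXACT hypothesis on the CM factor of the tree's named fact
  `Lombardo2016_hodgeClassesProductSpan` (file `HodgeGroupProductCMFactor`).

Brick E12c (`CMTimesNonCMEllipticProductsHodgeClasses`) proved this for `A` a REALISATION `(A, ι, θ)`
of one CM type `(K; Φ)`; brick E13b (same file) made the torus side abstract
(`MultiEllSlots.hodgeClasses_prod_mem_span_of_typeProj_polynomial`: any `A` with an endomorphism
`φ` in which all Hodge type projectors are polynomials); brick E13a
(`ComplexMultiplication/CMTypeHodgeProjectorsPolynomial`) supplies such a `φ = F^*`, `F ∈ End A`,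
for every `A` of CM type (Milne 2020 1.1–1.2 / Deligne LNM 900 Ex. 3.7, §4).  This file composes
them.

## Main statements (all sorry-free; no named fact is introduced or used)

* `MultiEllSlots.hodgeClasses_prod_mem_span_of_isOfCMType` — every rational `(p,p)`-class on `B × A`
  lies in the `ℂ`-span of `divisorHodgeProductClasses B A p` (= `fst^* a ⌣ snd^* b`, `a ∈ Dˡ(B) ⊗ ℂ`
  rational, `b` a rational `(k,k)`-class of `A`);
* `MultiEllSlots.hodgeClassesProductSpan_of_isOfCMType : HodgeClassesProductSpan B A` — the
  conclusion of `Lombardo2016_hodgeClassesProductSpan B A` PROVED for this class of `B` and EVERY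
  CM-type `A` (`lombardo2016_hodgeClassesProductSpan_multiEllSlots` states it in the fact's own
  binder shape);
* `MultiEllSlots.hodgeConjectureFor_prod_of_isOfCMType` — HC(`A`) ⟹ HC(`B × A`); the isogeny class;
* CONDITIONAL ON HC_CM (Milne's per-variety hypothesis `∀ X, Milne1999.CMHodgeHypothesisAt X`, which
  is the Summits item `RankFourFaces.CMAbelianHodge` by `Iff.rfl`; an explicit binder):
  `MultiEllSlots.hodgeConjectureFor_prod_of_cmHodgeHypothesis` — HC_CM ⟹ HC(`B × A`) for every
  CM-type `A`, WITHOUT the span binder `hL : Lombardo2016_hodgeClassesProductSpan` that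
  `hodgeConjectureFor_prod_of_cmHodgeHypothesis` (file `HodgeGroupProductCMFactor`) needs;
* UNCONDITIONAL instances: `A` of CM type of dimension `≤ 3` (HC for `A` is the tree's
  `hodgeConjectureFor_of_dim_le_three_holds`); `A` realising a nondegenerate CM type or a primitive
  CM type of prime degree (brick E12c, recovered: `IsCMTypeRealisation.isOfCMType`);
* §3: the same for `X₁ = E₀^{N₀+1} × ⋯ × E_r^{N_r+1}` (`multiPowSucc`).

## What is NOT here

Hazama's / Lombardo's theorem for a general `X₁` without type-IV factors
(`Lombardo2016_hodgeClassesProductSpan` itself) is NOT proved — only the class of `X₁` above, where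
`Hg(X₁)` is a product of `SL₂`'s acting through letters.  Moonen–Zarhin's second sentence "`X₁ × X₂`
again satisfies (D)" is not asserted (false for CM `X₂` with exceptional classes).  HC_CM is a
hypothesis wherever it occurs.

## References
* [Lombardo2016] D. Lombardo, *On the ℓ-adic Galois representations attached to nonsimple abelian
  varieties*, Ann. Inst. Fourier 66 (2016) 1217–1245 / arXiv:1402.1478, Lemma 3.4 (= Lemma 35),
  Remark 4.6.
* [MoonenZarhin1999LowDim] B. Moonen, Yu. Zarhin, *Hodge classes on abelian varieties of low
  dimension*, Math. Ann. 315 (1999), §3: Thm. (3.2)(2), (3.8), Cor. (3.9).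
* [Hazama1989] F. Hazama, *Algebraic cycles on nonsimple abelian varieties*, Duke Math. J. 58 (1989).
* [Milne1999] J. S. Milne, *Lefschetz motives and the Tate conjecture*, Compositio Math. 117 (1999),
  §2 p. 54, §7 p. 72.
* [Milne2020HodgeClassesAV] J. S. Milne, *Hodge classes on abelian varieties* (2020), 1.1–1.2.
* [Deligne1982HodgeCycles] P. Deligne, *Hodge cycles on abelian varieties*, LNM 900 (1982), Ex. 3.7, §4, §5.
* [VoisinHodgeII2003] C. Voisin, *Hodge Theory and Complex Algebraic Geometry II*, proof of Prop. 9.20.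
* [vanGeemen1994HodgeAV] B. van Geemen, LNM 1594 (1994), Lemma 3.7.
-/

noncomputable section

open CategoryTheory MonoidalCategory CartesianMonoidalCategory NumberField Module
open Literature.AlgebraicGeometry.Motives (AbelianVariety CMType)
open Literature.AlgebraicGeometry.ComplexMultiplication (IsCMTypeRealisation
  exists_forall_sum_smul_typeProj_mem_span_pow_of_isOfCMType)
open Literature.AlgebraicGeometry.Milne1999 (IsOfCMType CMHodgeHypothesisAt)

namespace Literature.AlgebraicGeometry.HodgeTheory

/-! ### §1 `B × A`, `A` of CM type (étale form) -/

section Main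

variable {ι : Type*} [Fintype ι] [DecidableEq ι] {E : ι → AbelianVariety ℂ} {B : AbelianVariety ℂ}
  {m : ι → ℕ} {g : (i : ι) → Fin (m i) → (B ⟶ E i)} {A : AbelianVariety ℂ}

/-- **Lombardo Lemma 3.4 / Moonen–Zarhin (3.2)(2) on Hodge classes, for `X₁` a product of powers of
non-CM curves and `X₂` ANY abelian variety of CM type: `B^p(B × A) ⊆ ∑_{l+k=p} fst^* D^l(B) ⌣ snd^* B^k(A)`
(complexified).** Let `B` carry a multi-curve slot structure over elliptic curves `E_i` WITHOUT
complex multiplication and pairwise NOT Hodge-isogenous, and let `A` be of CM type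
(`Milne1999.IsOfCMType A`). Then every rational `(p,p)`-class on `B × A` lies in the `ℂ`-span of the
classes `fst^* a ⌣ snd^* b`, `a ∈ Dˡ(B) ⊗ ℂ` rational, `b` a rational `(k,k)`-class of `A`. Printed:
"Suppose `B` is of CM type and `A_K̄` has no simple factor of type IV. Then we have
`H(A × B) ≅ H(A) × H(B)`" [Lombardo, Lemma 3.4]; "Suppose `X₁` has no factors of Type 4 and `X₂` is of
CM-type. Then […] `Hg(X₁ × X₂) = Hg(X₁) × Hg(X₂)`" [Moonen–Zarhin (3.2)(2)].  Proof: brick E13b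
(`MultiEllSlots.hodgeClasses_prod_mem_span_of_typeProj_polynomial`) at the endomorphism `F` of brick
E13a (`exists_forall_sum_smul_typeProj_mem_span_pow_of_isOfCMType`: all Hodge type projectors of `A`
are polynomials in `F^*`).
[cite: Lombardo2016, Lemma 3.4 (p. 1229; = Lemma 35 of arXiv:1402.1478)]
[cite: MoonenZarhin1999LowDim, Thm. (3.2)(2) and §3] [cite: Hazama1989, Thm.] -/
theorem MultiEllSlots.hodgeClasses_prod_mem_span_of_isOfCMType (hg : MultiEllSlots E B m g)
    (hE : ∀ i, (E i).dim = 1) (hT : ∀ i, EllipticCurve.HodgeEndTrivial (E i))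
    (hni : ∀ i k, i ≠ k → ¬ EllipticCurve.HodgeIsogenous (E i) (E k))
    (hA : IsOfCMType A) (p : ℕ) (c : complexBetti (B.X ⊗ A.X) (2 * p))
    (hcQ : IsRationalClass c) (hc : IsOfHodgeType (B.dim + A.dim) (B.X ⊗ A.X) (2 * p) p p c) :
    c ∈ Submodule.span ℂ (divisorHodgeProductClasses B A p) := by
  obtain ⟨F, hF⟩ := exists_forall_sum_smul_typeProj_mem_span_pow_of_isOfCMType hA
  exact hg.hodgeClasses_prod_mem_span_of_typeProj_polynomial hE hT hni F.hom.hom.hom hF p c hcQ hc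

/-- **`HodgeClassesProductSpan B A` for every CM-type `A`**: the Hodge classes of `B × A` are spanned
by exterior products of Hodge classes of the factors — the conclusion of the named fact
`Lombardo2016_hodgeClassesProductSpan B A`, PROVED for `B` a product of powers of non-CM pairwise
non-isogenous elliptic curves (with slot structure) and `A` of CM type.
[cite: Lombardo2016, Lemma 3.4 (p. 1229; = Lemma 35 of arXiv:1402.1478)]
[cite: MoonenZarhin1999LowDim, Thm. (3.2)(2) and §3] -/
theorem MultiEllSlots.hodgeClassesProductSpan_of_isOfCMType (hg : MultiEllSlots E B m g)
    (hE : ∀ i, (E i).dim = 1) (hT : ∀ i, EllipticCurve.HodgeEndTrivial (E i))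
    (hni : ∀ i k, i ≠ k → ¬ EllipticCurve.HodgeIsogenous (E i) (E k)) (hA : IsOfCMType A) :
    HodgeClassesProductSpan B A := fun p c hcQ hc =>
  Submodule.span_mono (divisorHodgeProductClasses_subset B A p)
    (hg.hodgeClasses_prod_mem_span_of_isOfCMType hE hT hni hA p c hcQ hc)

/-- **The binder shape of `Lombardo2016_hodgeClassesProductSpan`, discharged on this class**: for
`B` with a multi-curve slot structure over non-CM pairwise non-isogenous elliptic curves, the
instance `∀ C, HasNoTypeIVFactor B → IsOfCMType C → HodgeClassesProductSpan B C` of the named fact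
holds (the type-IV hypothesis is not even used: `Hg(B)` is a product of `SL₂`'s).
[cite: Lombardo2016, Lemma 3.4 (p. 1229; = Lemma 35 of arXiv:1402.1478)] -/
theorem MultiEllSlots.lombardo2016_hodgeClassesProductSpan (hg : MultiEllSlots E B m g)
    (hE : ∀ i, (E i).dim = 1) (hT : ∀ i, EllipticCurve.HodgeEndTrivial (E i))
    (hni : ∀ i k, i ≠ k → ¬ EllipticCurve.HodgeIsogenous (E i) (E k)) (C : AbelianVariety ℂ) :
    HasNoTypeIVFactor B → IsOfCMType C → HodgeClassesProductSpan B C :=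
  fun _ hC => hg.hodgeClassesProductSpan_of_isOfCMType hE hT hni hC

/-- **HC(`A`) ⟹ HC(`B × A`) for every CM-type `A`** (exterior products of algebraic classes are
algebraic, the tree's `hodgeConjectureFor_prod_of_productSpan`; HC for `B` is the tree's unconditional
`MultiEllSlots.hodgeConjectureFor`). [cite: MoonenZarhin1999LowDim, Thm. (3.2)(2) and (3.8)]
[cite: VoisinHodgeII2003, proof of Prop. 9.20 (first display)] -/
theorem MultiEllSlots.hodgeConjectureFor_prod_of_isOfCMType (hg : MultiEllSlots E B m g)
    (hE : ∀ i, (E i).dim = 1) (hT : ∀ i, EllipticCurve.HodgeEndTrivial (E i))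
    (hni : ∀ i k, i ≠ k → ¬ EllipticCurve.HodgeIsogenous (E i) (E k)) (hA : IsOfCMType A)
    (hAHC : HodgeConjectureFor A.dim A.X) : HodgeConjectureFor (B.prod A).dim (B.prod A).X :=
  hodgeConjectureFor_prod_of_productSpan B A (hg.hodgeClassesProductSpan_of_isOfCMType hE hT hni hA)
    (hg.hodgeConjectureFor hE hT hni) hAHC

/-- **Isogeny invariance** (van Geemen Lemma 3.7 = the tree's `HodgeConjectureFor.of_isIsogenous`):
HC(`A`) ⟹ HC(`X`) for every `X` isogenous to `B × A`. [cite: vanGeemen1994HodgeAV, Lemma 3.7]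
[cite: MoonenZarhin1999LowDim, Thm. (3.2)(2)] -/
theorem MultiEllSlots.hodgeConjectureFor_of_isIsogenous_prod_of_isOfCMType (hg : MultiEllSlots E B m g)
    (hE : ∀ i, (E i).dim = 1) (hT : ∀ i, EllipticCurve.HodgeEndTrivial (E i))
    (hni : ∀ i k, i ≠ k → ¬ EllipticCurve.HodgeIsogenous (E i) (E k)) (hA : IsOfCMType A)
    (hAHC : HodgeConjectureFor A.dim A.X) {X : AbelianVariety ℂ} (hX : X.IsIsogenous (B.prod A)) :
    HodgeConjectureFor X.dim X.X :=
  HodgeConjectureFor.of_isIsogenous hX (hg.hodgeConjectureFor_prod_of_isOfCMType hE hT hni hA hAHC)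

/-! ### §1b Conditional on HC_CM (an explicit binder): every CM-type factor -/

/-- **HC_CM ⟹ HC(`B × A`) for `B` a product of powers of non-CM pairwise non-isogenous elliptic curves
(with slot structure) and `A` ANY abelian variety of CM type** (ring 2; HONEST FRAMING: research
route conditional on HC_CM; not a corollary; Q11.4-sentence-2 already refuted in dim ≥ 3 — no
transport is used here). Hypothesis `hCM`: the Hodge conjecture for all complex CM abelian varieties
in Milne's per-variety form (`∀ X, Milne1999.CMHodgeHypothesisAt X` = the summit item
`RankFourFaces.CMAbelianHodge` by `Iff.rfl`). Compared with `hodgeConjectureFor_prod_of_cmHodgeHypothesis`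
(file `HodgeGroupProductCMFactor`), the span binder `hL : Lombardo2016_hodgeClassesProductSpan` is GONE:
it is the theorem `MultiEllSlots.hodgeClassesProductSpan_of_isOfCMType` on this class.
[cite: Lombardo2016, Lemma 3.4 (p. 1229; = Lemma 35 of arXiv:1402.1478)] [cite: Milne1999, §7 p. 72] -/
theorem MultiEllSlots.hodgeConjectureFor_prod_of_cmHodgeHypothesis (hg : MultiEllSlots E B m g)
    (hE : ∀ i, (E i).dim = 1) (hT : ∀ i, EllipticCurve.HodgeEndTrivial (E i))
    (hni : ∀ i k, i ≠ k → ¬ EllipticCurve.HodgeIsogenous (E i) (E k))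
    (hCM : ∀ X : AbelianVariety ℂ, CMHodgeHypothesisAt X) (hA : IsOfCMType A) :
    HodgeConjectureFor (B.prod A).dim (B.prod A).X :=
  hg.hodgeConjectureFor_prod_of_isOfCMType hE hT hni hA
    (hCM A Motives.AbelianVariety.isSmoothProjective_holds hA)

/-- **HC_CM ⟹ HC(`X`) for every `X` isogenous to `B × A`**, `B`, `A` as above.
[cite: vanGeemen1994HodgeAV, Lemma 3.7] [cite: Milne1999, §7 p. 72] -/
theorem MultiEllSlots.hodgeConjectureFor_of_isIsogenous_prod_of_cmHodgeHypothesis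
    (hg : MultiEllSlots E B m g) (hE : ∀ i, (E i).dim = 1) (hT : ∀ i, EllipticCurve.HodgeEndTrivial (E i))
    (hni : ∀ i k, i ≠ k → ¬ EllipticCurve.HodgeIsogenous (E i) (E k))
    (hCM : ∀ X : AbelianVariety ℂ, CMHodgeHypothesisAt X) (hA : IsOfCMType A) {X : AbelianVariety ℂ}
    (hX : X.IsIsogenous (B.prod A)) : HodgeConjectureFor X.dim X.X :=
  HodgeConjectureFor.of_isIsogenous hX (hg.hodgeConjectureFor_prod_of_cmHodgeHypothesis hE hT hni hCM hA)

/-- **Two CM-type factors**: HC_CM ⟹ HC(`B × (A₁ × A₂)`) for `A₁`, `A₂` of CM type (`A₁ × A₂` is of CM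
type: the tree's `IsOfCMType.prod`; its Hodge classes need not be products of classes of the factors
— Shioda's examples — which is why HC_CM is invoked at `A₁ × A₂`). [cite: Milne1999, §2 p. 54 and §7 p. 72]
[cite: Lombardo2016, Lemma 3.4 and Remark 4.6] -/
theorem MultiEllSlots.hodgeConjectureFor_prod_prod_of_cmHodgeHypothesis (hg : MultiEllSlots E B m g)
    (hE : ∀ i, (E i).dim = 1) (hT : ∀ i, EllipticCurve.HodgeEndTrivial (E i))
    (hni : ∀ i k, i ≠ k → ¬ EllipticCurve.HodgeIsogenous (E i) (E k))
    (hCM : ∀ X : AbelianVariety ℂ, CMHodgeHypothesisAt X) {A₁ A₂ : AbelianVariety ℂ}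
    (hA₁ : IsOfCMType A₁) (hA₂ : IsOfCMType A₂) :
    HodgeConjectureFor (B.prod (A₁.prod A₂)).dim (B.prod (A₁.prod A₂)).X :=
  hg.hodgeConjectureFor_prod_of_cmHodgeHypothesis hE hT hni hCM (hA₁.prod hA₂)

/-! ### §1c Unconditional instances -/

/-- **UNCONDITIONAL: `B × A` for `A` of CM type of dimension `≤ 3`** (HC for `A` is the tree's
`hodgeConjectureFor_of_dim_le_three_holds`: Lefschetz `(1,1)` and hard Lefschetz; the content beyond
the factors is the splitting `B(B × A) = ∑ D(B) ⊗ B(A)`, e.g. for `A` a simple CM threefold or a product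
`E × S` of a CM curve and a simple CM surface). [cite: MoonenZarhin1999LowDim, Introduction and Thm. (3.2)(2)]
[cite: Lombardo2016, Lemma 3.4 (p. 1229; = Lemma 35 of arXiv:1402.1478)] -/
theorem MultiEllSlots.hodgeConjectureFor_prod_of_isOfCMType_of_dim_le_three (hg : MultiEllSlots E B m g)
    (hE : ∀ i, (E i).dim = 1) (hT : ∀ i, EllipticCurve.HodgeEndTrivial (E i))
    (hni : ∀ i k, i ≠ k → ¬ EllipticCurve.HodgeIsogenous (E i) (E k)) (hA : IsOfCMType A)
    (hd : A.dim ≤ 3) : HodgeConjectureFor (B.prod A).dim (B.prod A).X :=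
  hg.hodgeConjectureFor_prod_of_isOfCMType hE hT hni hA
    (hodgeConjectureFor_of_dim_le_three_holds hd Motives.AbelianVariety.isSmoothProjective_holds)

/-- **Brick E12c recovered**: a realisation `(A, ι, θ)` of a CM type of a CM field is of CM type in
the étale sense (the tree's `IsCMTypeRealisation.isOfCMType`), so `HodgeClassesProductSpan B A`
follows from the étale-form theorem as well. [cite: MoonenZarhin1999LowDim, Thm. (3.2)(2)]
[cite: Shimura1998, §5.2 (type `(F; {φ_i})`)] -/
theorem MultiEllSlots.hodgeClassesProductSpan_of_isCMTypeRealisation (hg : MultiEllSlots E B m g)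
    (hE : ∀ i, (E i).dim = 1) (hT : ∀ i, EllipticCurve.HodgeEndTrivial (E i))
    (hni : ∀ i k, i ≠ k → ¬ EllipticCurve.HodgeIsogenous (E i) (E k))
    {K : Type} [Field K] [NumberField K] [IsCMField K] {Φ : CMType K} {act : 𝓞 K →+* End A}
    {θ : K →+* Module.End ℂ (complexBetti A.X 1)} (hA : IsCMTypeRealisation Φ A act θ) :
    HodgeClassesProductSpan B A :=
  hg.hodgeClassesProductSpan_of_isOfCMType hE hT hni hA.isOfCMType

end Main

/-! ### §2 `E₀^{N₀+1} × ⋯ × E_r^{N_r+1} × A`, `A` of CM type -/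

section Products

variable {A : AbelianVariety ℂ}

/-- **`B(X × A)` is spanned by `fst^* D(X) ⌣ snd^* B(A)` for `X = E₀^{N₀+1} × ⋯ × E_r^{N_r+1}`**, the
`E_i` elliptic curves without complex multiplication and pairwise not Hodge-isogenous, `A` ANY abelian
variety of CM type. [cite: Lombardo2016, Lemma 3.4 (p. 1229; = Lemma 35 of arXiv:1402.1478)]
[cite: MoonenZarhin1999LowDim, Thm. (3.2)(2) and Cor. (3.9)] -/
theorem hodgeClassesProductSpan_multiPowSucc_of_isOfCMType (r : ℕ) (E : Fin (r + 1) → AbelianVariety ℂ)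
    (N : Fin (r + 1) → ℕ) (hE : ∀ i, (E i).dim = 1) (hT : ∀ i, EllipticCurve.HodgeEndTrivial (E i))
    (hni : ∀ i k, i ≠ k → ¬ EllipticCurve.HodgeIsogenous (E i) (E k)) (hA : IsOfCMType A) :
    HodgeClassesProductSpan (multiPowSucc r E N) A := by
  classical
  obtain ⟨E', m, g, h, hE'⟩ := exists_multiEllSlots_multiPowSucc r E N hE
  exact h.hodgeClassesProductSpan_of_isOfCMType (fun i => by rw [hE' i]; exact hE i)
    (fun i => by rw [hE' i]; exact hT i) (fun i k hik => by rw [hE' i, hE' k]; exact hni i k hik) hA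

/-- **HC(`A`) ⟹ HC(`E₀^{N₀+1} × ⋯ × E_r^{N_r+1} × A`)** for non-CM pairwise non-isogenous `E_i` and `A` of CM
type. [cite: MoonenZarhin1999LowDim, Thm. (3.2)(2)] [cite: Lombardo2016, Lemma 3.4] -/
theorem hodgeConjectureFor_multiPowSucc_prod_of_isOfCMType (r : ℕ) (E : Fin (r + 1) → AbelianVariety ℂ)
    (N : Fin (r + 1) → ℕ) (hE : ∀ i, (E i).dim = 1) (hT : ∀ i, EllipticCurve.HodgeEndTrivial (E i))
    (hni : ∀ i k, i ≠ k → ¬ EllipticCurve.HodgeIsogenous (E i) (E k)) (hA : IsOfCMType A)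
    (hAHC : HodgeConjectureFor A.dim A.X) :
    HodgeConjectureFor ((multiPowSucc r E N).prod A).dim ((multiPowSucc r E N).prod A).X :=
  hodgeConjectureFor_prod_of_productSpan _ A
    (hodgeClassesProductSpan_multiPowSucc_of_isOfCMType r E N hE hT hni hA)
    (hodgeConjectureFor_multiPowSucc r E N hE hT hni) hAHC

/-- **HC_CM ⟹ HC(`E₀^{N₀+1} × ⋯ × E_r^{N_r+1} × A`)**, `A` ANY abelian variety of CM type (research route
conditional on HC_CM; `hCM` is Milne's per-variety hypothesis, an explicit binder).
[cite: Milne1999, §7 p. 72] [cite: Lombardo2016, Lemma 3.4 (p. 1229; = Lemma 35 of arXiv:1402.1478)] -/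
theorem hodgeConjectureFor_multiPowSucc_prod_of_cmHodgeHypothesis (r : ℕ)
    (E : Fin (r + 1) → AbelianVariety ℂ) (N : Fin (r + 1) → ℕ) (hE : ∀ i, (E i).dim = 1)
    (hT : ∀ i, EllipticCurve.HodgeEndTrivial (E i))
    (hni : ∀ i k, i ≠ k → ¬ EllipticCurve.HodgeIsogenous (E i) (E k))
    (hCM : ∀ X : AbelianVariety ℂ, CMHodgeHypothesisAt X) (hA : IsOfCMType A) :
    HodgeConjectureFor ((multiPowSucc r E N).prod A).dim ((multiPowSucc r E N).prod A).X :=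
  hodgeConjectureFor_multiPowSucc_prod_of_isOfCMType r E N hE hT hni hA
    (hCM A Motives.AbelianVariety.isSmoothProjective_holds hA)

/-- **Isogeny class, conditional on HC_CM**: HC for every `X` isogenous to
`E₀^{N₀+1} × ⋯ × E_r^{N_r+1} × A`, `E_i` non-CM pairwise non-isogenous, `A` of CM type.
[cite: vanGeemen1994HodgeAV, Lemma 3.7] [cite: Milne1999, §7 p. 72] -/
theorem hodgeConjectureFor_of_isIsogenous_multiPowSucc_prod_of_cmHodgeHypothesis (r : ℕ)
    (E : Fin (r + 1) → AbelianVariety ℂ) (N : Fin (r + 1) → ℕ) (hE : ∀ i, (E i).dim = 1)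
    (hT : ∀ i, EllipticCurve.HodgeEndTrivial (E i))
    (hni : ∀ i k, i ≠ k → ¬ EllipticCurve.HodgeIsogenous (E i) (E k))
    (hCM : ∀ X : AbelianVariety ℂ, CMHodgeHypothesisAt X) (hA : IsOfCMType A) {X : AbelianVariety ℂ}
    (hX : X.IsIsogenous ((multiPowSucc r E N).prod A)) : HodgeConjectureFor X.dim X.X :=
  HodgeConjectureFor.of_isIsogenous hX
    (hodgeConjectureFor_multiPowSucc_prod_of_cmHodgeHypothesis r E N hE hT hni hCM hA)

/-- **UNCONDITIONAL: `E₀^{N₀+1} × ⋯ × E_r^{N_r+1} × A` for `A` of CM type of dimension `≤ 3`.**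
[cite: MoonenZarhin1999LowDim, Introduction and Thm. (3.2)(2)] [cite: Lombardo2016, Lemma 3.4] -/
theorem hodgeConjectureFor_multiPowSucc_prod_of_isOfCMType_of_dim_le_three (r : ℕ)
    (E : Fin (r + 1) → AbelianVariety ℂ) (N : Fin (r + 1) → ℕ) (hE : ∀ i, (E i).dim = 1)
    (hT : ∀ i, EllipticCurve.HodgeEndTrivial (E i))
    (hni : ∀ i k, i ≠ k → ¬ EllipticCurve.HodgeIsogenous (E i) (E k)) (hA : IsOfCMType A)
    (hd : A.dim ≤ 3) :
    HodgeConjectureFor ((multiPowSucc r E N).prod A).dim ((multiPowSucc r E N).prod A).X :=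
  hodgeConjectureFor_multiPowSucc_prod_of_isOfCMType r E N hE hT hni hA
    (hodgeConjectureFor_of_dim_le_three_holds hd Motives.AbelianVariety.isSmoothProjective_holds)

/-! ### On-path lemma: every target is a case of the Hodge conjecture -/

/-- **On path**: the Hodge conjecture for all smooth projective complex varieties gives every
`HodgeConjectureFor` statement of this file (they are CASES of the summit statement; nothing
stronger is claimed). [cite: Deligne2000, §1] -/
theorem hodgeConjectureFor_multiPowSucc_prod_of_hodgeConjecture
    (h : ∀ ⦃n : ℕ⦄ ⦃X : Motives.SchemeOver ℂ⦄, Motives.IsSmoothProjective n X → HodgeConjectureFor n X)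
    (r : ℕ) (E : Fin (r + 1) → AbelianVariety ℂ) (N : Fin (r + 1) → ℕ) (A : AbelianVariety ℂ) :
    HodgeConjectureFor ((multiPowSucc r E N).prod A).dim ((multiPowSucc r E N).prod A).X :=
  h Motives.AbelianVariety.isSmoothProjective_holds

end Products

end Literature.AlgebraicGeometry.HodgeTheory

end
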